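import Literature.Probability.FitznerVanDerHofstad2017.SrwTUSupTableD10
import Literature.Probability.FitznerVanDerHofstad2017.F3BoundsCellReductionAlt
import Literature.Probability.FitznerVanDerHofstad2017.F3BoundsCellSplitAlt
import HarnessLib

/-!
# The `f₃` cell theorems at `d := 10` with the `T` / `U` / `K` cell sups read BY NAME

PACKET. b2b-lace packet, LEAN TYPING SEAT 1 gen 24 (unit `b2b-lace-lean1-g24`).  HOME/LEMMAS node D10-CELLSUP (`lean1-g24:claim1`): the
CONSUMER WIRING of the landed `d := 10` sup and point literals of the SRW tables (`SrwKSupTableD10`, `SrwTUSupTableD10`,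
`SrwKTUTablesD10`) into the `f₃` cell theorems of `F3BoundsCellReductionAlt` / `F3BoundsCellSplitAlt`: the `T^{(5.11)}`-slot `srwTS`
at `d := 10`, the region shapes `𝒳 = calX 10`, `Q`, the three cones and the nodes, and the cell theorems at `d := 10` with the seven
`T`/`U`/`K` cell-sup binders discharged BY NAME (with the (5.11)-rule `T` literal, §3, or the direct slot literal, §5).  Additive (no module modified); hypothesis-free; instantiates NO certificate and NO
`…Of 10` structure; every table value is a landed literal read by name; no numeral of record; no dimension sentence.

CITATION HEADER (PLACEMENT v2). Part of a certified REPRODUCTION of R. Fitzner, R. van der Hofstad, *Generalized approach to the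
non-backtracking lace expansion*, PTRF **169** (2017) 1041–1119 [NoBLE17], §3.3.5 (3.87) (the bound on `f₃` as a maximum over cells
`{n,l,S}` of suprema `sup_{x ∈ S}` of expressions linear and monotone in the SRW table entries `T_{m,l}(x)`, `U_{m,l}(x)`, `K_{m,l}(x)`,
(3.71)–(3.86)) and §5.2 (5.9)–(5.15) p. 1090–1092 (the bounds on `T`, `U`, `K`), and of R. Fitzner, R. van der Hofstad, *Mean-field
behavior for nearest-neighbor percolation in `d > 10`*, EJP **22** (2017) no. 43 [FvdH17], §2.5 ((2.23): the set `𝒳`; the numerical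
verification reads every table at the lowest-order points of the cell):

> [NoBLE17] (5.11): "`T_{n,l}(x) ≤ K_{n,l+1}(x) + min{(4/d) K_{n,l}(x), (2/d) K_{n+1,l}(x)}`" and p. 1079: "the supremum over `S` is
> attained at one of the lowest-order points of `S`".

Every `[cite:]` tag below is a LOCATOR for comparison, not an appeal to authority: all statements are proved here from tree theorems.
The second quoted sentence is NOT used: every cell sup below is a kernel-certified SUP LITERAL of `SrwKSupTableD10` /
`SrwTUSupTableD10` (regions `Σ_μ |x_μ| ≥ 2`, `≥ 3`) or a point literal of `SrwKTUTablesD10` read AT a node.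

## What is here (`d := 10`; all proved; no hypothesis on any table value)

§0 SLOT FUNCTIONS (the landed `ℚ` literals cast to `ℝ`, in the argument order of `F3Bounds.Tables.cell`): `kX uX tX` (region `𝒳`:
   `KSupD10.kS2`, `TUSupD10.uS2`, `TUSupD10.tS2`), `kQ uQ tQ` (region `Q = {Σ_j |x_j| ≥ 3}`: `kS3`, `uS3`, `tS3`), `kN uN tN nd` (the point
   literals `KTUD10.kA / uA / tA · · nd` at the node `nd`, in particular the origin `nd = n0`); the set `Q10` and the inclusions of the three
   cones `absCone (vecOfParts 10 [3] / [2,1] / [1,1,1]) ⊆ Q10`.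
§1 THE `T^{(5.11)}`-SLOT.  The `T` column of the alternative true tables is `srwTS d α̲ m l x = K_{m,l+1}(x) + (2/α̲) U_{m+1,l}(x)`
   (`srwTS_le_srwTrueAlt_T`); for `1 ≤ α̲` it is bounded by the right side of (5.11) (`srwTS_le_of_one_le`), hence by the `T`-rule of
   `SrwTUSupTableD10` against any family of `K`-bounds valid at `x`: `srwTS_le_of_tRule` (`1 ≤ m ≤ 3`, `l ≤ 21`), and the headlines
   `srwTS_le_tS2_of_two_le`, `srwTS_le_tS3_of_three_le`, `srwTS_le_tA_pt` (the rule tables are re-decided here by `decide +kernel`).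
§2 REGION THEOREMS IN CONSUMER SHAPE — literally the binder types of `F3Bounds.boundHD75_srwTrueAlt_{zero,one}_cell_le` (`∀ x ∈ calX 10, …`),
   `…_{zero,one}_le_on` (`∀ x ∈ C, …` for `C ⊆ Q10`), `…_one_zero_le` (values at `0`) and `…_{zero,one}_at_le` (values at a node).
§3 THE WIRED CELL THEOREMS `f3cellD10_*`: the landed cell theorems at `d := 10` with the `T`/`U`/`K` binders discharged by §2 and the slot
   functions of §0; the REMAINING hypotheses are `1 ≤ α̲`, `1 ≤ ᾱ`, `a.WF`, the `IM`-side (`CellDomAlt` / `OnDomAlt` / `OriginDomAlt` / entry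
   values at a node, print's `m = −1` pair) and the closing constant inequality `hnum` — `α̲`, `ᾱ`, `a`, `IMc`, `b` are PARAMETERS.
§4 THE PER-CONE READING of an `𝒳`-cell: `𝒳 = {2e₁, e₁+e₂}^{sym} ∪ (three cones)`, so a cell bound over `𝒳` also follows from the two node
   values (`f3cellD10_*_at_le e2 / e11`) and the three cone bounds (`f3cellD10_*_on_le`): `f3cellD10_calX_le_of_nodes_of_cones`.
§5 THE DIRECT SLOT LITERALS.  Since the slot IS `K_{m,l+1} + (2/α̲) U_{m+1,l}` by definition, it is also bounded — with no rule table and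
   exactly in `α̲` — by the landed `K`-sup literal at `(m,l+1)` plus `2/α̲` times the landed (5.9)-certified `U`-sup literal at `(m+1,l)`
   (`srwTS_le_direct`); `tXD α̲ / tQD α̲ / tND α̲ nd := min (rule literal) (direct form)` (never worse than §0's `tX / tQ / tN nd`), their
   region theorems `srwTS_calX_le_tXD`, `srwTS_le_tQD_on`, `srwTS_pt_le_tND`, `srwTS_zero_le_tND`, and the nine cell theorems re-wired with
   them, `f3cellD10D_*` (node / origin cells for `l ≤ 16`, the `uA` rows stopping at `l = 17`).  The measurement that the direct form is the
   smaller one at `α̲ = 1` in 21/66 `𝒳`-cells and 15/66 `Q`-cells (low `l`) is the twin `enum1-g42`'s (SLOT-PRICE-D10, scratch); nothing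
   here depends on it.

## What is NOT here
No certificate, no value of `α̲`, `ᾱ`, `a`, `IMc` or `b`, no engine number, no `𝒥`/`I`-table, no statement in any other dimension; the tables
of record and every `d = 11` module are untouched; no `…Of 10` structure is instantiated.  Heartbeat census: three `decide +kernel` rule-table
checks (§1) and two node-coordinate identities (§4), everything else (§0, §2, §3, §5) is a one-line composition; no option is set.
-/

noncomputable section

namespace Literature.Probability.FitznerVanDerHofstad2017

open Finset Real
open Literature.Barriers.CriticalPhenomena Literature.Probability.LatticeModels
open F3Bounds KTUD10 KSupD10 TUSupD10

namespace CellSupD10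

/-! ### §0  Slot functions and the region `Q` -/

/-- `K`-slot over `𝒳`: the sup literal `kS2 n l` (`Σ_μ |x_μ| ≥ 2`). [cite: FitznerVanDerHofstad2016NoBLE, §3.3.5 (3.87) p. 1079; (5.15) p. 1092] -/
def kX (n l : ℕ) : ℝ := ((kS2 n l : ℚ) : ℝ)

/-- `U`-slot over `𝒳`: the sup literal `uS2 n l`. [cite: FitznerVanDerHofstad2016NoBLE, §3.3.5 (3.87) p. 1079; (5.9), (5.12) p. 1092] -/
def uX (n l : ℕ) : ℝ := ((uS2 n l : ℚ) : ℝ)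

/-- `T^{(5.11)}`-slot over `𝒳`: the sup literal `tS2 m l`. [cite: FitznerVanDerHofstad2016NoBLE, §3.3.5 (3.87) p. 1079; (5.11) p. 1092] -/
def tX (m l : ℕ) : ℝ := ((tS2 m l : ℚ) : ℝ)

/-- `K`-slot over `Q = {Σ_μ |x_μ| ≥ 3}`: `kS3 n l`. [cite: FitznerVanDerHofstad2016NoBLE, §3.3.5 (3.87) p. 1079; §5.1 p. 1093; (5.15) p. 1092] -/
def kQ (n l : ℕ) : ℝ := ((kS3 n l : ℚ) : ℝ)

/-- `U`-slot over `Q`: `uS3 n l`. [cite: FitznerVanDerHofstad2016NoBLE, §3.3.5 (3.87) p. 1079; §5.1 p. 1093; (5.9), (5.12) p. 1092] -/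
def uQ (n l : ℕ) : ℝ := ((uS3 n l : ℚ) : ℝ)

/-- `T^{(5.11)}`-slot over `Q`: `tS3 m l`. [cite: FitznerVanDerHofstad2016NoBLE, §3.3.5 (3.87) p. 1079; §5.1 p. 1093; (5.11) p. 1092] -/
def tQ (m l : ℕ) : ℝ := ((tS3 m l : ℚ) : ℝ)

/-- `K`-slot AT the node `nd` (in particular the origin `nd = n0`): the point literal `kA n l nd`.
[cite: FitznerVanDerHofstad2016NoBLE, §3.3.5 (3.87) p. 1079 (cell `{0}`); (5.15) p. 1092] -/
def kN (nd : Nd) (n l : ℕ) : ℝ := ((kA n l nd : ℚ) : ℝ)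

/-- `U`-slot AT the node `nd`: the point literal `uA n l nd`. [cite: FitznerVanDerHofstad2016NoBLE, §3.3.5 (3.87) p. 1079 (cell `{0}`); (5.9), (5.12) p. 1092] -/
def uN (nd : Nd) (n l : ℕ) : ℝ := ((uA n l nd : ℚ) : ℝ)

/-- `T^{(5.11)}`-slot AT the node `nd`: the point literal `tA m l nd`. [cite: FitznerVanDerHofstad2016NoBLE, §3.3.5 (3.87) p. 1079 (cell `{0}`); (5.11) p. 1092] -/
def tN (nd : Nd) (m l : ℕ) : ℝ := ((tA m l nd : ℚ) : ℝ)

/-- The far region `Q = {x ∈ ℤ^{10} : Σ_j |x_j| ≥ 3}`. [cite: FitznerVanDerHofstad2016NoBLE, §5.1 p. 1093 (the set `Q`)] -/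
def Q10 : Set (Fin 10 → ℤ) := {x | 3 ≤ ∑ j, |x j|}

/-- Membership in `Q10` is the `ℓ¹` condition (definitional). [cite: FitznerVanDerHofstad2016NoBLE, §5.1 p. 1093 (the set `Q`)] -/
theorem mem_Q10 {x : Fin 10 → ℤ} : x ∈ Q10 ↔ 3 ≤ ∑ j, |x j| := Iff.rfl

/-- The cone of `3e₁` lies in `Q`. [cite: FitznerVanDerHofstad2016NoBLE, §5.1 p. 1093] -/
theorem absCone_three_subset_Q10 : absCone (vecOfParts 10 [3]) ⊆ Q10 :=
  fun _ hx => three_le_sum_abs_of_mem_absCone_three (by norm_num) hx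

/-- The cone of `2e₁+e₂` lies in `Q`. [cite: FitznerVanDerHofstad2016NoBLE, §5.1 p. 1093] -/
theorem absCone_two_one_subset_Q10 : absCone (vecOfParts 10 [2, 1]) ⊆ Q10 :=
  fun _ hx => three_le_sum_abs_of_mem_absCone_two_one (by norm_num) hx

/-- The cone of `e₁+e₂+e₃` lies in `Q`. [cite: FitznerVanDerHofstad2016NoBLE, §5.1 p. 1093] -/
theorem absCone_one_one_one_subset_Q10 : absCone (vecOfParts 10 [1, 1, 1]) ⊆ Q10 :=
  fun _ hx => three_le_sum_abs_of_mem_absCone_one_one_one (by norm_num) hx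

/-! ### §1  The `T^{(5.11)}`-slot `srwTS 10 a m l` (`1 ≤ a`) -/

/-- **Soundness of the `T`-rule for the `T^{(5.11)}`-slot**: for `1 ≤ a`, `1 ≤ m ≤ 3`, `l ≤ 21`, any family `KS` of `K`-bounds valid at
`x` (`1 ≤ n' ≤ 4`, `l' ≤ 22`) and `tRule KS m l t`, `srwTS 10 a m l x ≤ t` — (5.11) for the slot (`srwTS_le_of_one_le`) with its
`K`-entries majorised. [cite: FitznerVanDerHofstad2016NoBLE, §5.2 (5.11) p. 1092; §3.3.5 (3.72) p. 1077] -/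
theorem srwTS_le_of_tRule {a : ℝ} (ha : 1 ≤ a) {m : ℕ} (hm1 : 1 ≤ m) (hm : m ≤ 3) {l : ℕ} (hl : l ≤ 21)
    (x : Fin 10 → ℤ) (KS : ℕ → ℕ → ℚ) (t : ℚ)
    (hK : ∀ n' ≤ 4, 1 ≤ n' → ∀ l' ≤ 22, srwK 10 n' l' x ≤ ((KS n' l' : ℚ) : ℝ))
    (h : tRule KS m l t = true) : srwTS 10 a m l x ≤ ((t : ℚ) : ℝ) := by
  have hd : 2 * (m + 1) + 1 ≤ 10 := by omega
  have h0 : srwTS 10 a m l x ≤ srwK 10 m (l + 1) x +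
      min (4 / ((10 : ℕ) : ℝ) * srwK 10 m l x) (2 / ((10 : ℕ) : ℝ) * srwK 10 (m + 1) l x) :=
    srwTS_le_of_one_le hd ha l x
  simp only [tRule, Bool.and_eq_true, Bool.or_eq_true, decide_eq_true_eq] at h
  have hk1 := hK m (by omega) hm1 (l + 1) (by omega)
  rcases h with h4 | ⟨hn3, h2⟩
  · have hk0 := hK m (by omega) hm1 l (by omega)
    have hmin : min (4 / ((10 : ℕ) : ℝ) * srwK 10 m l x) (2 / ((10 : ℕ) : ℝ) * srwK 10 (m + 1) l x) ≤
        4 / ((10 : ℕ) : ℝ) * ((KS m l : ℚ) : ℝ) :=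
      (min_le_left _ _).trans (mul_le_mul_of_nonneg_left hk0 (by positivity))
    refine h0.trans ((add_le_add hk1 hmin).trans ?_)
    have e : ((KS m (l + 1) : ℚ) : ℝ) + 4 / ((10 : ℕ) : ℝ) * ((KS m l : ℚ) : ℝ) =
        ((KS m (l + 1) + 4 / 10 * KS m l : ℚ) : ℝ) := by
      push_cast; ring
    rw [e]
    exact_mod_cast h4
  · have hk0 := hK (m + 1) (by omega) (by omega) l (by omega)
    have hmin : min (4 / ((10 : ℕ) : ℝ) * srwK 10 m l x) (2 / ((10 : ℕ) : ℝ) * srwK 10 (m + 1) l x) ≤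
        2 / ((10 : ℕ) : ℝ) * ((KS (m + 1) l : ℚ) : ℝ) :=
      (min_le_right _ _).trans (mul_le_mul_of_nonneg_left hk0 (by positivity))
    refine h0.trans ((add_le_add hk1 hmin).trans ?_)
    have e : ((KS m (l + 1) : ℚ) : ℝ) + 2 / ((10 : ℕ) : ℝ) * ((KS (m + 1) l : ℚ) : ℝ) =
        ((KS m (l + 1) + 2 / 10 * KS (m + 1) l : ℚ) : ℝ) := by
      push_cast; ring
    rw [e]
    exact_mod_cast h2

/-- [folklore] -/
private theorem tChk2_all' : ∀ m ≤ 3, 1 ≤ m → ∀ l ≤ 21, tRule kS2 m l (tS2 m l) = true := by decide +kernel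

/-- [folklore] -/
private theorem tChk3_all' : ∀ m ≤ 3, 1 ≤ m → ∀ l ≤ 21, tRule kS3 m l (tS3 m l) = true := by decide +kernel

/-- [folklore] -/
private theorem taChk_all' (nd : Nd) : ∀ m ≤ 3, 1 ≤ m → ∀ l ≤ 21, tRule (fun n l => kA n l nd) m l (tA m l nd) = true := by
  cases nd <;> decide +kernel

/-- **HEADLINE (`T^{(5.11)}`-slot, sup over `Σ_μ |x_μ| ≥ 2`).** `srwTS 10 a m l x ≤ tS2 m l` for `1 ≤ a`, `1 ≤ m ≤ 3`, `l ≤ 21` — the sup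
literal of `SrwTUSupTableD10` also bounds the slot; hypothesis-free. [cite: FitznerVanDerHofstad2016NoBLE, §5.2 (5.11) p. 1092; §3.3.5 (3.87) p. 1079] -/
theorem srwTS_le_tS2_of_two_le {a : ℝ} (ha : 1 ≤ a) {m : ℕ} (hm1 : 1 ≤ m) (hm : m ≤ 3) {l : ℕ} (hl : l ≤ 21)
    (x : Fin 10 → ℤ) (hx : 2 ≤ ∑ μ, |x μ|) : srwTS 10 a m l x ≤ ((tS2 m l : ℚ) : ℝ) :=
  srwTS_le_of_tRule ha hm1 hm hl x kS2 _ (fun _ hn' hn1' _ hl' => srwK_le_kS2 hn1' hn' hl' x hx)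
    (tChk2_all' m hm hm1 l hl)

/-- **HEADLINE (`T^{(5.11)}`-slot, sup over `Σ_μ |x_μ| ≥ 3`).** `srwTS 10 a m l x ≤ tS3 m l` for `1 ≤ a`, `1 ≤ m ≤ 3`, `l ≤ 21`.
[cite: FitznerVanDerHofstad2016NoBLE, §5.2 (5.11) p. 1092; §5.1 p. 1093] -/
theorem srwTS_le_tS3_of_three_le {a : ℝ} (ha : 1 ≤ a) {m : ℕ} (hm1 : 1 ≤ m) (hm : m ≤ 3) {l : ℕ} (hl : l ≤ 21)
    (x : Fin 10 → ℤ) (hx : 3 ≤ ∑ μ, |x μ|) : srwTS 10 a m l x ≤ ((tS3 m l : ℚ) : ℝ) :=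
  srwTS_le_of_tRule ha hm1 hm hl x kS3 _ (fun _ hn' hn1' _ hl' => srwK_le_kS3 hn1' hn' hl' x hx)
    (tChk3_all' m hm hm1 l hl)

/-- **HEADLINE (`T^{(5.11)}`-slot AT a node).** `srwTS 10 a m l (nd.pt) ≤ tA m l nd` for `1 ≤ a`, `1 ≤ m ≤ 3`, `l ≤ 21` — the point literal
`tA` of `SrwKTUTablesD10` (certified there for the true `T`) also bounds the slot, by the same rule on the `kA` point literals.
[cite: FitznerVanDerHofstad2016NoBLE, §5.2 (5.11) p. 1092; §3.3.5 (3.87) p. 1079 (cell `{0}`)] -/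
theorem srwTS_le_tA_pt {a : ℝ} (ha : 1 ≤ a) (nd : Nd) {m : ℕ} (hm1 : 1 ≤ m) (hm : m ≤ 3) {l : ℕ} (hl : l ≤ 21) :
    srwTS 10 a m l nd.pt ≤ ((tA m l nd : ℚ) : ℝ) :=
  srwTS_le_of_tRule ha hm1 hm hl nd.pt (fun n l => kA n l nd) _ (fun _ hn' hn1' _ hl' => srwK_le_kA nd hn1' hn' hl')
    (taChk_all' nd m hm hm1 l hl)

/-! ### §2  Region theorems in the consumer shape -/

/-- `∀ x ∈ 𝒳, K_{n,l}(x) ≤ kX n l` (`1 ≤ n ≤ 4`, `l ≤ 22`): the binder `hK·` of `boundHD75_srwTrueAlt_{zero,one}_cell_le` at `d := 10`.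
[cite: FitznerVanDerHofstad2016NoBLE, §3.3.5 (3.87) p. 1079; (5.15) p. 1092] [cite: FitznerVanDerHofstad2017, (2.23) (the set `𝒳`)] -/
theorem srwK_calX_le {n : ℕ} (hn1 : 1 ≤ n) (hn : n ≤ 4) {l : ℕ} (hl : l ≤ 22) :
    ∀ x ∈ calX 10, srwK 10 n l x ≤ kX n l :=
  fun x hx => srwK_le_kS2 hn1 hn hl x (two_le_sum_abs_of_mem_calX x hx)

/-- `∀ x ∈ 𝒳, U_{n,l}(x) ≤ uX n l` (`1 ≤ n ≤ 4`, `l ≤ 22`). [cite: FitznerVanDerHofstad2016NoBLE, §3.3.5 (3.87) p. 1079; (5.9), (5.12) p. 1092] [cite: FitznerVanDerHofstad2017, (2.23)] -/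
theorem srwU_calX_le {n : ℕ} (hn1 : 1 ≤ n) (hn : n ≤ 4) {l : ℕ} (hl : l ≤ 22) :
    ∀ x ∈ calX 10, srwU 10 n l x ≤ uX n l :=
  fun x hx => srwU_le_uS2 hn1 hn hl x (two_le_sum_abs_of_mem_calX x hx)

/-- `∀ x ∈ 𝒳, T^{(5.11)}_{m,l}(x) ≤ tX m l` for the slot `srwTS 10 a` (`1 ≤ a`, `1 ≤ m ≤ 3`, `l ≤ 21`).
[cite: FitznerVanDerHofstad2016NoBLE, §3.3.5 (3.87) p. 1079; (5.11) p. 1092] [cite: FitznerVanDerHofstad2017, (2.23)] -/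
theorem srwTS_calX_le {a : ℝ} (ha : 1 ≤ a) {m : ℕ} (hm1 : 1 ≤ m) (hm : m ≤ 3) {l : ℕ} (hl : l ≤ 21) :
    ∀ x ∈ calX 10, srwTS 10 a m l x ≤ tX m l :=
  fun x hx => srwTS_le_tS2_of_two_le ha hm1 hm hl x (two_le_sum_abs_of_mem_calX x hx)

/-- `∀ x ∈ C, K_{n,l}(x) ≤ kQ n l` for every `C ⊆ Q10` (`Q10` itself, the three cones): the binder `hK·` of
`boundHD75_srwTrueAlt_{zero,one}_le_on` at `d := 10`. [cite: FitznerVanDerHofstad2016NoBLE, §3.3.5 (3.87) p. 1079; §5.1 p. 1093; (5.15) p. 1092] -/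
theorem srwK_le_kQ_on {C : Set (Fin 10 → ℤ)} (hC : C ⊆ Q10) {n : ℕ} (hn1 : 1 ≤ n) (hn : n ≤ 4) {l : ℕ} (hl : l ≤ 22) :
    ∀ x ∈ C, srwK 10 n l x ≤ kQ n l :=
  fun x hx => srwK_le_kS3 hn1 hn hl x (hC hx)

/-- `∀ x ∈ C, U_{n,l}(x) ≤ uQ n l` for every `C ⊆ Q10`. [cite: FitznerVanDerHofstad2016NoBLE, §3.3.5 (3.87) p. 1079; §5.1 p. 1093; (5.9), (5.12) p. 1092] -/
theorem srwU_le_uQ_on {C : Set (Fin 10 → ℤ)} (hC : C ⊆ Q10) {n : ℕ} (hn1 : 1 ≤ n) (hn : n ≤ 4) {l : ℕ} (hl : l ≤ 22) :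
    ∀ x ∈ C, srwU 10 n l x ≤ uQ n l :=
  fun x hx => srwU_le_uS3 hn1 hn hl x (hC hx)

/-- `∀ x ∈ C, T^{(5.11)}_{m,l}(x) ≤ tQ m l` for every `C ⊆ Q10` (`1 ≤ a`, `1 ≤ m ≤ 3`, `l ≤ 21`).
[cite: FitznerVanDerHofstad2016NoBLE, §3.3.5 (3.87) p. 1079; §5.1 p. 1093; (5.11) p. 1092] -/
theorem srwTS_le_tQ_on {C : Set (Fin 10 → ℤ)} (hC : C ⊆ Q10) {a : ℝ} (ha : 1 ≤ a) {m : ℕ} (hm1 : 1 ≤ m) (hm : m ≤ 3)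
    {l : ℕ} (hl : l ≤ 21) : ∀ x ∈ C, srwTS 10 a m l x ≤ tQ m l :=
  fun x hx => srwTS_le_tS3_of_three_le ha hm1 hm hl x (hC hx)

/-- `K_{n,l}(nd.pt) ≤ kN nd n l` (`l ≤ 22`): the point read at a node. [cite: FitznerVanDerHofstad2016NoBLE, §3.3.5 (3.87) p. 1079; (5.15) p. 1092] -/
theorem srwK_pt_le (nd : Nd) {n : ℕ} (hn1 : 1 ≤ n) (hn : n ≤ 4) {l : ℕ} (hl : l ≤ 22) :
    srwK 10 n l nd.pt ≤ kN nd n l :=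
  srwK_le_kA nd hn1 hn hl

/-- `U_{n,l}(nd.pt) ≤ uN nd n l` (`l ≤ 17`). [cite: FitznerVanDerHofstad2016NoBLE, §3.3.5 (3.87) p. 1079; (5.9), (5.12) p. 1092] -/
theorem srwU_pt_le (nd : Nd) {n : ℕ} (hn1 : 1 ≤ n) (hn : n ≤ 4) {l : ℕ} (hl : l ≤ 17) :
    srwU 10 n l nd.pt ≤ uN nd n l :=
  srwU_le_uA nd hn1 hn hl

/-- `T^{(5.11)}_{m,l}(nd.pt) ≤ tN nd m l` for the slot (`1 ≤ a`, `1 ≤ m ≤ 3`, `l ≤ 21`). [cite: FitznerVanDerHofstad2016NoBLE, §3.3.5 (3.87) p. 1079; (5.11) p. 1092] -/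
theorem srwTS_pt_le {a : ℝ} (ha : 1 ≤ a) (nd : Nd) {m : ℕ} (hm1 : 1 ≤ m) (hm : m ≤ 3) {l : ℕ} (hl : l ≤ 21) :
    srwTS 10 a m l nd.pt ≤ tN nd m l :=
  srwTS_le_tA_pt ha nd hm1 hm hl

/-- `K_{n,l}(0) ≤ kN n0 n l`: the origin value (binder `hK·` of `boundHD75_srwTrueAlt_one_zero_le` at `d := 10`).
[cite: FitznerVanDerHofstad2016NoBLE, §3.3.5 (3.87) p. 1079 (cell `{0}`); (5.15) p. 1092] -/
theorem srwK_zero_le {n : ℕ} (hn1 : 1 ≤ n) (hn : n ≤ 4) {l : ℕ} (hl : l ≤ 22) : srwK 10 n l 0 ≤ kN .n0 n l := by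
  have h := srwK_pt_le .n0 hn1 hn hl
  rwa [Nd.pt_n0] at h

/-- `U_{n,l}(0) ≤ uN n0 n l` (`l ≤ 17`). [cite: FitznerVanDerHofstad2016NoBLE, §3.3.5 (3.87) p. 1079 (cell `{0}`); (5.9), (5.12) p. 1092] -/
theorem srwU_zero_le {n : ℕ} (hn1 : 1 ≤ n) (hn : n ≤ 4) {l : ℕ} (hl : l ≤ 17) : srwU 10 n l 0 ≤ uN .n0 n l := by
  have h := srwU_pt_le .n0 hn1 hn hl
  rwa [Nd.pt_n0] at h

/-- `T^{(5.11)}_{m,l}(0) ≤ tN n0 m l` for the slot (`1 ≤ a`, `1 ≤ m ≤ 3`, `l ≤ 21`). [cite: FitznerVanDerHofstad2016NoBLE, §3.3.5 (3.87) p. 1079 (cell `{0}`); (5.11) p. 1092] -/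
theorem srwTS_zero_le {a : ℝ} (ha : 1 ≤ a) {m : ℕ} (hm1 : 1 ≤ m) (hm : m ≤ 3) {l : ℕ} (hl : l ≤ 21) :
    srwTS 10 a m l 0 ≤ tN .n0 m l := by
  have h := srwTS_pt_le ha .n0 hm1 hm hl
  rwa [Nd.pt_n0] at h

/-! ### §3  The wired cell theorems at `d := 10` -/

variable {afmin afmax : ℝ}

/-- **Cell `(0,l)` over `𝒳` at `d := 10`, `T`/`U`/`K` slots read by name** (`l ≤ 20`): from `1 ≤ α̲`, `1 ≤ ᾱ`, `a.WF`, one `CellDomAlt` per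
read natural-row `IM` entry, print's `m = −1` node pair and `boundHD75 (Tables.cell IMc tX uX kX) 0 l 0 a ≤ b`, conclude
`boundHD75 (srwTrueAlt 10 α̲ ᾱ) 0 l x a ≤ b` for every `x ∈ 𝒳` — `boundHD75_srwTrueAlt_zero_cell_le` with `hT2 hT2' hT1 hU2 hU3 hK1 hK2`
discharged by §2. [cite: FitznerVanDerHofstad2016NoBLE, §3.3.5 (3.87) p. 1079; (3.71)–(3.86)] [cite: FitznerVanDerHofstad2017, §2.5; notebook General.nb In[2]–In[3]] -/
theorem f3cellD10_zero_calX_le (hα : 1 ≤ afmin) (hᾱ : 1 ≤ afmax) {a : Args} (ha : a.WF)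
    {IMc : ℤ → ℕ → ℝ} {l : ℕ} (hl : l ≤ 20) {b : ℝ}
    (hE0 : CellDomAlt 10 afmin afmax 0 l (IMc 0 l)) (hE0' : CellDomAlt 10 afmin afmax 0 (l + 1) (IMc 0 (l + 1)))
    (hN1 : srwINode2 10 1 (l + 1) + srwIShift2Node2 10 2 l / (2 * ((10 : ℕ) : ℝ) ^ 2 * afmin) ≤ IMc (-1) l)
    (hN2 : srwINode2 10 2 l ≤ ((10 : ℕ) : ℝ) * afmin * IMc (-1) l)
    (hnum : boundHD75 (Tables.cell IMc tX uX kX : Tables (Fin 10 → ℤ)) 0 l 0 a ≤ b) :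
    ∀ x ∈ calX 10, boundHD75 (srwTrueAlt 10 afmin afmax) 0 l x a ≤ b :=
  boundHD75_srwTrueAlt_zero_cell_le (by norm_num) (by linarith) hᾱ ha hE0 hE0' hN1 hN2
    (srwTS_calX_le hα (by norm_num) (by norm_num) (by omega)) (srwTS_calX_le hα (by norm_num) (by norm_num) (by omega))
    (srwTS_calX_le hα (by norm_num) (by norm_num) (by omega))
    (srwU_calX_le (by norm_num) (by norm_num) (by omega)) (srwU_calX_le (by norm_num) (by norm_num) (by omega))
    (srwK_calX_le (by norm_num) (by norm_num) (by omega)) (srwK_calX_le (by norm_num) (by norm_num) (by omega)) hnum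

/-- **Cells `(1,l)` over `𝒳` at `d := 10`, `T`/`U`/`K` slots read by name** (`l ≤ 20`): `boundHD75_srwTrueAlt_one_cell_le` with
`hT3 hT3' hT2 hU3 hU4 hK2 hK3` discharged by §2. [cite: FitznerVanDerHofstad2016NoBLE, §3.3.5 (3.87) p. 1079; (3.71)–(3.86)] [cite: FitznerVanDerHofstad2017, §2.5; notebook General.nb In[2]–In[3]] -/
theorem f3cellD10_one_calX_le (hα : 1 ≤ afmin) (hᾱ : 1 ≤ afmax) {a : Args} (ha : a.WF)
    {IMc : ℤ → ℕ → ℝ} {l : ℕ} (hl : l ≤ 20) {b : ℝ}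
    (hE1 : CellDomAlt 10 afmin afmax 1 l (IMc 1 l)) (hE0 : CellDomAlt 10 afmin afmax 0 l (IMc 0 l))
    (hE1' : CellDomAlt 10 afmin afmax 1 (l + 1) (IMc 1 (l + 1))) (hE0' : CellDomAlt 10 afmin afmax 0 (l + 1) (IMc 0 (l + 1)))
    (hE1'' : CellDomAlt 10 afmin afmax 1 (l + 2) (IMc 1 (l + 2)))
    (hnum : boundHD75 (Tables.cell IMc tX uX kX : Tables (Fin 10 → ℤ)) 1 l 0 a ≤ b) :
    ∀ x ∈ calX 10, boundHD75 (srwTrueAlt 10 afmin afmax) 1 l x a ≤ b :=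
  boundHD75_srwTrueAlt_one_cell_le (by norm_num) (by linarith) hᾱ ha hE1 hE0 hE1' hE0' hE1''
    (srwTS_calX_le hα (by norm_num) (by norm_num) (by omega)) (srwTS_calX_le hα (by norm_num) (by norm_num) (by omega))
    (srwTS_calX_le hα (by norm_num) (by norm_num) (by omega))
    (srwU_calX_le (by norm_num) (by norm_num) (by omega)) (srwU_calX_le (by norm_num) (by norm_num) (by omega))
    (srwK_calX_le (by norm_num) (by norm_num) (by omega)) (srwK_calX_le (by norm_num) (by norm_num) (by omega)) hnum

/-- **Cell `(0,l)` over a set `C ⊆ Q10` at `d := 10`, `T`/`U`/`K` slots read by name** (`C = Q10` or one of the three cones; `l ≤ 20`):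
`boundHD75_srwTrueAlt_zero_le_on` with the seven `T`/`U`/`K` binders discharged by the `Q`-slot literals `tQ uQ kQ`.
[cite: FitznerVanDerHofstad2016NoBLE, §3.3.5 (3.87) p. 1079; §5.1 p. 1093; (3.71)–(3.86)] [cite: FitznerVanDerHofstad2017, §2.5; notebook Percolation.nb (`boundF3[2,o]`, `boundF3[3,o]`)] -/
theorem f3cellD10_zero_on_le {C : Set (Fin 10 → ℤ)} (hC : C ⊆ Q10) (hα : 1 ≤ afmin) (hᾱ : 1 ≤ afmax) {a : Args} (ha : a.WF)
    {IMc : ℤ → ℕ → ℝ} {l : ℕ} (hl : l ≤ 20) {b : ℝ}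
    (hE0 : OnDomAlt 10 afmin afmax C 0 l (IMc 0 l)) (hE0' : OnDomAlt 10 afmin afmax C 0 (l + 1) (IMc 0 (l + 1)))
    (hN1 : ∀ x ∈ C, srwI 10 1 (l + 1) x + srwIShift2 10 2 l x / (2 * ((10 : ℕ) : ℝ) ^ 2 * afmin) ≤ IMc (-1) l)
    (hN2 : ∀ x ∈ C, srwI 10 2 l x ≤ ((10 : ℕ) : ℝ) * afmin * IMc (-1) l)
    (hnum : boundHD75 (Tables.cell IMc tQ uQ kQ : Tables (Fin 10 → ℤ)) 0 l 0 a ≤ b) :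
    ∀ x ∈ C, boundHD75 (srwTrueAlt 10 afmin afmax) 0 l x a ≤ b :=
  boundHD75_srwTrueAlt_zero_le_on (by norm_num) (by linarith) hᾱ ha C hE0 hE0' hN1 hN2
    (srwTS_le_tQ_on hC hα (by norm_num) (by norm_num) (by omega)) (srwTS_le_tQ_on hC hα (by norm_num) (by norm_num) (by omega))
    (srwTS_le_tQ_on hC hα (by norm_num) (by norm_num) (by omega))
    (srwU_le_uQ_on hC (by norm_num) (by norm_num) (by omega)) (srwU_le_uQ_on hC (by norm_num) (by norm_num) (by omega))
    (srwK_le_kQ_on hC (by norm_num) (by norm_num) (by omega)) (srwK_le_kQ_on hC (by norm_num) (by norm_num) (by omega)) hnum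

/-- **Cells `(1,l)` over a set `C ⊆ Q10` at `d := 10`, `T`/`U`/`K` slots read by name** (`l ≤ 20`): `boundHD75_srwTrueAlt_one_le_on` with
the seven binders discharged by `tQ uQ kQ`. [cite: FitznerVanDerHofstad2016NoBLE, §3.3.5 (3.87) p. 1079; §5.1 p. 1093; (3.71)–(3.86)] [cite: FitznerVanDerHofstad2017, §2.5; notebook Percolation.nb (`boundF3[3,o]`)] -/
theorem f3cellD10_one_on_le {C : Set (Fin 10 → ℤ)} (hC : C ⊆ Q10) (hα : 1 ≤ afmin) (hᾱ : 1 ≤ afmax) {a : Args} (ha : a.WF)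
    {IMc : ℤ → ℕ → ℝ} {l : ℕ} (hl : l ≤ 20) {b : ℝ}
    (hE1 : OnDomAlt 10 afmin afmax C 1 l (IMc 1 l)) (hE0 : OnDomAlt 10 afmin afmax C 0 l (IMc 0 l))
    (hE1' : OnDomAlt 10 afmin afmax C 1 (l + 1) (IMc 1 (l + 1))) (hE0' : OnDomAlt 10 afmin afmax C 0 (l + 1) (IMc 0 (l + 1)))
    (hE1'' : OnDomAlt 10 afmin afmax C 1 (l + 2) (IMc 1 (l + 2)))
    (hnum : boundHD75 (Tables.cell IMc tQ uQ kQ : Tables (Fin 10 → ℤ)) 1 l 0 a ≤ b) :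
    ∀ x ∈ C, boundHD75 (srwTrueAlt 10 afmin afmax) 1 l x a ≤ b :=
  boundHD75_srwTrueAlt_one_le_on (by norm_num) (by linarith) hᾱ ha C hE1 hE0 hE1' hE0' hE1''
    (srwTS_le_tQ_on hC hα (by norm_num) (by norm_num) (by omega)) (srwTS_le_tQ_on hC hα (by norm_num) (by norm_num) (by omega))
    (srwTS_le_tQ_on hC hα (by norm_num) (by norm_num) (by omega))
    (srwU_le_uQ_on hC (by norm_num) (by norm_num) (by omega)) (srwU_le_uQ_on hC (by norm_num) (by norm_num) (by omega))
    (srwK_le_kQ_on hC (by norm_num) (by norm_num) (by omega)) (srwK_le_kQ_on hC (by norm_num) (by norm_num) (by omega)) hnum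

/-- **Cell `(0,l)` on all of `Q` in the shape of the hypothesis `h0Q`** of `nobleWeightedDiagramBoundAt_of_witness_srwTrueAlt_smallX`
(`∀ x, 3 ≤ Σ_j |x_j| → …`): `f3cellD10_zero_on_le` at `C = Q10`. [cite: FitznerVanDerHofstad2016NoBLE, §3.3.5 (3.87) p. 1079; §5.1 p. 1093] [cite: FitznerVanDerHofstad2017, §2.5; notebook Percolation.nb (`boundF3[2,o]`)] -/
theorem f3cellD10_zero_Q_le (hα : 1 ≤ afmin) (hᾱ : 1 ≤ afmax) {a : Args} (ha : a.WF)
    {IMc : ℤ → ℕ → ℝ} {l : ℕ} (hl : l ≤ 20) {b : ℝ}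
    (hE0 : OnDomAlt 10 afmin afmax Q10 0 l (IMc 0 l)) (hE0' : OnDomAlt 10 afmin afmax Q10 0 (l + 1) (IMc 0 (l + 1)))
    (hN1 : ∀ x ∈ Q10, srwI 10 1 (l + 1) x + srwIShift2 10 2 l x / (2 * ((10 : ℕ) : ℝ) ^ 2 * afmin) ≤ IMc (-1) l)
    (hN2 : ∀ x ∈ Q10, srwI 10 2 l x ≤ ((10 : ℕ) : ℝ) * afmin * IMc (-1) l)
    (hnum : boundHD75 (Tables.cell IMc tQ uQ kQ : Tables (Fin 10 → ℤ)) 0 l 0 a ≤ b) :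
    ∀ x : Fin 10 → ℤ, 3 ≤ ∑ j, |x j| → boundHD75 (srwTrueAlt 10 afmin afmax) 0 l x a ≤ b :=
  fun x hx => f3cellD10_zero_on_le subset_rfl hα hᾱ ha hl hE0 hE0' hN1 hN2 hnum x hx

/-- **Cell `(1,l)` on all of `Q` in the shape of the hypothesis `h1Q`** (`∀ x, 3 ≤ Σ_j |x_j| → …`): `f3cellD10_one_on_le` at `C = Q10`.
[cite: FitznerVanDerHofstad2016NoBLE, §3.3.5 (3.87) p. 1079; §5.1 p. 1093] [cite: FitznerVanDerHofstad2017, §2.5; notebook Percolation.nb (`boundF3[3,o]`)] -/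
theorem f3cellD10_one_Q_le (hα : 1 ≤ afmin) (hᾱ : 1 ≤ afmax) {a : Args} (ha : a.WF)
    {IMc : ℤ → ℕ → ℝ} {l : ℕ} (hl : l ≤ 20) {b : ℝ}
    (hE1 : OnDomAlt 10 afmin afmax Q10 1 l (IMc 1 l)) (hE0 : OnDomAlt 10 afmin afmax Q10 0 l (IMc 0 l))
    (hE1' : OnDomAlt 10 afmin afmax Q10 1 (l + 1) (IMc 1 (l + 1))) (hE0' : OnDomAlt 10 afmin afmax Q10 0 (l + 1) (IMc 0 (l + 1)))
    (hE1'' : OnDomAlt 10 afmin afmax Q10 1 (l + 2) (IMc 1 (l + 2)))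
    (hnum : boundHD75 (Tables.cell IMc tQ uQ kQ : Tables (Fin 10 → ℤ)) 1 l 0 a ≤ b) :
    ∀ x : Fin 10 → ℤ, 3 ≤ ∑ j, |x j| → boundHD75 (srwTrueAlt 10 afmin afmax) 1 l x a ≤ b :=
  fun x hx => f3cellD10_one_on_le subset_rfl hα hᾱ ha hl hE1 hE0 hE1' hE0' hE1'' hnum x hx

/-- **Cell `(1,l)` at the origin at `d := 10`, `T`/`U`/`K` slots read by name** (`l ≤ 17`): `boundHD75_srwTrueAlt_one_zero_le` with the
origin values `hT3 hT3' hT2 hU3 hU4 hK2 hK3` discharged by the point literals at the node `n0` (`tN uN kN n0`).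
[cite: FitznerVanDerHofstad2016NoBLE, §3.3.5 (3.87) p. 1079 (cell `{0}`); (3.30), (3.35)] [cite: FitznerVanDerHofstad2017, §2.5; notebook Percolation.nb (`boundF3[1,o]`)] -/
theorem f3cellD10_one_zero_le (hα : 1 ≤ afmin) {a : Args} (ha : a.WF)
    {IMc : ℤ → ℕ → ℝ} {l : ℕ} (hl : l ≤ 17) {b : ℝ}
    (hE1 : OriginDomAlt 10 afmin afmax 1 l (IMc 1 l)) (hE0 : OriginDomAlt 10 afmin afmax 0 l (IMc 0 l))
    (hE1' : OriginDomAlt 10 afmin afmax 1 (l + 1) (IMc 1 (l + 1))) (hE0' : OriginDomAlt 10 afmin afmax 0 (l + 1) (IMc 0 (l + 1)))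
    (hE1'' : OriginDomAlt 10 afmin afmax 1 (l + 2) (IMc 1 (l + 2)))
    (hnum : boundHD75 (Tables.cell IMc (tN .n0) (uN .n0) (kN .n0) : Tables (Fin 10 → ℤ)) 1 l 0 a ≤ b) :
    boundHD75 (srwTrueAlt 10 afmin afmax) 1 l 0 a ≤ b :=
  boundHD75_srwTrueAlt_one_zero_le (by norm_num) (by linarith) ha hE1 hE0 hE1' hE0' hE1''
    (srwTS_zero_le hα (by norm_num) (by norm_num) (by omega)) (srwTS_zero_le hα (by norm_num) (by norm_num) (by omega))
    (srwTS_zero_le hα (by norm_num) (by norm_num) (by omega))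
    (srwU_zero_le (by norm_num) (by norm_num) (by omega)) (srwU_zero_le (by norm_num) (by norm_num) (by omega))
    (srwK_zero_le (by norm_num) (by norm_num) (by omega)) (srwK_zero_le (by norm_num) (by norm_num) (by omega)) hnum

/-- **Cell `(0,l)` AT the node `nd` at `d := 10`, `T`/`U`/`K` slots read by name** (`l ≤ 17`; the shell nodes `nd = e2`, `e11` of the
per-cone reading of an `𝒳`-cell): `boundHD75_srwTrueAlt_zero_at_le` with the `T`/`U`/`K` values at `nd.pt` discharged by `tN uN kN nd`; the
`IM` entry values at the node and print's `m = −1` pair stay hypotheses. [cite: FitznerVanDerHofstad2016NoBLE, §3.3.5 (3.87) p. 1079; (3.71)–(3.86)] [cite: FitznerVanDerHofstad2017, §2.5, notebook Percolation.nb] -/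
theorem f3cellD10_zero_at_le (hα : 1 ≤ afmin) {a : Args} (ha : a.WF) (nd : Nd)
    {IMc : ℤ → ℕ → ℝ} {l : ℕ} (hl : l ≤ 17) {b : ℝ}
    (hE0 : (srwTrueAlt 10 afmin afmax).IM 0 l nd.pt ≤ IMc 0 l) (hE0' : (srwTrueAlt 10 afmin afmax).IM 0 (l + 1) nd.pt ≤ IMc 0 (l + 1))
    (hN1 : srwI 10 1 (l + 1) nd.pt + srwIShift2 10 2 l nd.pt / (2 * ((10 : ℕ) : ℝ) ^ 2 * afmin) ≤ IMc (-1) l)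
    (hN2 : srwI 10 2 l nd.pt ≤ ((10 : ℕ) : ℝ) * afmin * IMc (-1) l)
    (hnum : boundHD75 (Tables.cell IMc (tN nd) (uN nd) (kN nd) : Tables (Fin 10 → ℤ)) 0 l 0 a ≤ b) :
    boundHD75 (srwTrueAlt 10 afmin afmax) 0 l nd.pt a ≤ b :=
  boundHD75_srwTrueAlt_zero_at_le (by norm_num) (by linarith) ha nd.pt hE0 hE0' hN1 hN2
    (srwTS_pt_le hα nd (by norm_num) (by norm_num) (by omega)) (srwTS_pt_le hα nd (by norm_num) (by norm_num) (by omega))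
    (srwTS_pt_le hα nd (by norm_num) (by norm_num) (by omega))
    (srwU_pt_le nd (by norm_num) (by norm_num) (by omega)) (srwU_pt_le nd (by norm_num) (by norm_num) (by omega))
    (srwK_pt_le nd (by norm_num) (by norm_num) (by omega)) (srwK_pt_le nd (by norm_num) (by norm_num) (by omega)) hnum

/-- **Cells `(1,l)` AT the node `nd` at `d := 10`, `T`/`U`/`K` slots read by name** (`l ≤ 17`): `boundHD75_srwTrueAlt_one_at_le` with the
`T`/`U`/`K` values at `nd.pt` discharged by `tN uN kN nd`. [cite: FitznerVanDerHofstad2016NoBLE, §3.3.5 (3.87) p. 1079; (3.71)–(3.86)] [cite: FitznerVanDerHofstad2017, §2.5, notebook Percolation.nb] -/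
theorem f3cellD10_one_at_le (hα : 1 ≤ afmin) {a : Args} (ha : a.WF) (nd : Nd)
    {IMc : ℤ → ℕ → ℝ} {l : ℕ} (hl : l ≤ 17) {b : ℝ}
    (hE1 : (srwTrueAlt 10 afmin afmax).IM 1 l nd.pt ≤ IMc 1 l) (hE0 : (srwTrueAlt 10 afmin afmax).IM 0 l nd.pt ≤ IMc 0 l)
    (hE1' : (srwTrueAlt 10 afmin afmax).IM 1 (l + 1) nd.pt ≤ IMc 1 (l + 1))
    (hE0' : (srwTrueAlt 10 afmin afmax).IM 0 (l + 1) nd.pt ≤ IMc 0 (l + 1))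
    (hE1'' : (srwTrueAlt 10 afmin afmax).IM 1 (l + 2) nd.pt ≤ IMc 1 (l + 2))
    (hnum : boundHD75 (Tables.cell IMc (tN nd) (uN nd) (kN nd) : Tables (Fin 10 → ℤ)) 1 l 0 a ≤ b) :
    boundHD75 (srwTrueAlt 10 afmin afmax) 1 l nd.pt a ≤ b :=
  boundHD75_srwTrueAlt_one_at_le ha nd.pt hE1 hE0 hE1' hE0' hE1''
    (srwTS_pt_le hα nd (by norm_num) (by norm_num) (by omega)) (srwTS_pt_le hα nd (by norm_num) (by norm_num) (by omega))
    (srwTS_pt_le hα nd (by norm_num) (by norm_num) (by omega))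
    (srwU_pt_le nd (by norm_num) (by norm_num) (by omega)) (srwU_pt_le nd (by norm_num) (by norm_num) (by omega))
    (srwK_pt_le nd (by norm_num) (by norm_num) (by omega)) (srwK_pt_le nd (by norm_num) (by norm_num) (by omega)) hnum

/-! ### §4  The per-cone reading of an `𝒳`-cell at `d := 10` -/

/-- The shell node `2e₁` of `𝒳` is `vecOfParts 10 [2]`. [cite: FitznerVanDerHofstad2016NoBLE, §3.3.5 p. 1079 (the lowest-order points `2e₁`, `e₁+e₂` of `𝒳`)] -/
theorem pt_e2_eq_vecOfParts : Nd.pt .e2 = vecOfParts 10 [2] := by decide +kernel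

/-- The shell node `e₁+e₂` of `𝒳` is `classVec 10 2 0`. [cite: FitznerVanDerHofstad2016NoBLE, §3.3.5 p. 1079 (the lowest-order points `2e₁`, `e₁+e₂` of `𝒳`)] -/
theorem pt_e11_eq_classVec : Nd.pt .e11 = classVec 10 2 0 := by decide +kernel

/-- **Per-cone reading of an `𝒳`-cell at `d := 10`**: a cell bound over `𝒳 = calX 10` from its values AT the two shell nodes `e2`, `e11`
(supplied by `f3cellD10_{zero,one}_at_le`) and bounds on the three cones of `3e₁`, `2e₁+e₂`, `e₁+e₂+e₃` (supplied by
`f3cellD10_{zero,one}_on_le` with `absCone_*_subset_Q10`) — `boundHD75_srwTrueAlt_calX_le_of_nodes_of_absCones` at `d := 10` with the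
node points named by `KTUD10.Nd`. [cite: FitznerVanDerHofstad2016NoBLE, §3.3.5 (3.87) p. 1079; §5.1 p. 1093] [cite: FitznerVanDerHofstad2017, §2.5; notebook Percolation.nb (`boundF3[3,o]` read per cone)] -/
theorem f3cellD10_calX_le_of_nodes_of_cones {n l : ℕ} {a : Args} {b : ℝ}
    (h2 : boundHD75 (srwTrueAlt 10 afmin afmax) n l (Nd.pt .e2) a ≤ b)
    (h11 : boundHD75 (srwTrueAlt 10 afmin afmax) n l (Nd.pt .e11) a ≤ b)
    (h3 : ∀ x ∈ absCone (vecOfParts 10 [3]), boundHD75 (srwTrueAlt 10 afmin afmax) n l x a ≤ b)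
    (h21 : ∀ x ∈ absCone (vecOfParts 10 [2, 1]), boundHD75 (srwTrueAlt 10 afmin afmax) n l x a ≤ b)
    (h111 : ∀ x ∈ absCone (vecOfParts 10 [1, 1, 1]), boundHD75 (srwTrueAlt 10 afmin afmax) n l x a ≤ b) :
    ∀ x ∈ calX 10, boundHD75 (srwTrueAlt 10 afmin afmax) n l x a ≤ b := by
  rw [pt_e2_eq_vecOfParts] at h2
  rw [pt_e11_eq_classVec] at h11
  exact boundHD75_srwTrueAlt_calX_le_of_nodes_of_absCones (by norm_num) h2 h11 h3 h21 h111

/-! ### §5  The DIRECT slot literals `min (rule literal) (K_{m,l+1}-sup + (2/a)·U_{m+1,l}-sup)` and the cells wired with them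

The slot is `srwTS d a m l x = K_{m,l+1}(x) + (2/a) U_{m+1,l}(x)` BY DEFINITION (`NobleH2Step.srwTS`), so besides the (5.11)-rule literal it is
bounded DIRECTLY by the landed `K`-sup literal at `(m,l+1)` plus `2/a` times the landed (5.9)-certified `U`-sup literal at `(m+1,l)` — no rule table,
exact in `a`. The twin `enum1-g42` (SLOT-PRICE-D10) measured that the direct form is strictly smaller than the rule literal at `a = 1` in 21/66
`𝒳`-cells and 15/66 `Q`-cells (low `l`) and larger at high `l`; the literals below take the `min`, so they are never worse than §0's. -/

/-- **The slot bounded directly**: `srwTS 10 a m l x ≤ k + (2/a)·u` from `K_{m,l+1}(x) ≤ k`, `U_{m+1,l}(x) ≤ u` (`0 < a`).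
[cite: FitznerVanDerHofstad2016NoBLE, §3.3.5 (3.72) p. 1077; §5.2 (5.9), (5.15) p. 1092] -/
theorem srwTS_le_direct {a : ℝ} (ha : 0 < a) {m l : ℕ} (x : Fin 10 → ℤ) {k u : ℝ}
    (hk : srwK 10 m (l + 1) x ≤ k) (hu : srwU 10 (m + 1) l x ≤ u) : srwTS 10 a m l x ≤ k + 2 / a * u := by
  unfold srwTS
  exact add_le_add hk (mul_le_mul_of_nonneg_left hu (by positivity))

/-- DIRECT `T`-slot literal on `𝒳`: `min (tX m l) (kX m (l+1) + (2/a)·uX (m+1) l)`. [cite: FitznerVanDerHofstad2016NoBLE, §5.2 (5.9), (5.11), (5.15) p. 1092] -/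
def tXD (a : ℝ) (m l : ℕ) : ℝ := min (tX m l) (kX m (l + 1) + 2 / a * uX (m + 1) l)

/-- DIRECT `T`-slot literal on `Q10` (and the three cones): `min (tQ m l) (kQ m (l+1) + (2/a)·uQ (m+1) l)`. [cite: FitznerVanDerHofstad2016NoBLE, §5.2 (5.9), (5.11), (5.15) p. 1092; §5.1 p. 1093] -/
def tQD (a : ℝ) (m l : ℕ) : ℝ := min (tQ m l) (kQ m (l + 1) + 2 / a * uQ (m + 1) l)

/-- DIRECT `T`-slot literal AT the node `nd`: `min (tN nd m l) (kN nd m (l+1) + (2/a)·uN nd (m+1) l)`. [cite: FitznerVanDerHofstad2016NoBLE, §5.2 (5.9), (5.11), (5.15) p. 1092; §3.3.5 (3.87) p. 1079 (cell `{0}`)] -/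
def tND (a : ℝ) (nd : Nd) (m l : ℕ) : ℝ := min (tN nd m l) (kN nd m (l + 1) + 2 / a * uN nd (m + 1) l)

/-- `∀ x ∈ 𝒳, srwTS 10 a m l x ≤ tXD a m l` (`1 ≤ a`, `1 ≤ m ≤ 3`, `l ≤ 21`). [cite: FitznerVanDerHofstad2016NoBLE, §3.3.5 (3.87) p. 1079; §5.2 (5.9), (5.11), (5.15) p. 1092] [cite: FitznerVanDerHofstad2017, (2.23)] -/
theorem srwTS_calX_le_tXD {a : ℝ} (ha : 1 ≤ a) {m : ℕ} (hm1 : 1 ≤ m) (hm : m ≤ 3) {l : ℕ} (hl : l ≤ 21) :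
    ∀ x ∈ calX 10, srwTS 10 a m l x ≤ tXD a m l :=
  fun x hx => le_min (srwTS_calX_le ha hm1 hm hl x hx)
    (srwTS_le_direct (by linarith) x (srwK_calX_le hm1 (by omega) (by omega) x hx)
      (srwU_calX_le (by omega) (by omega) (by omega) x hx))

/-- `∀ x ∈ C, srwTS 10 a m l x ≤ tQD a m l` for every `C ⊆ Q10` (`1 ≤ a`, `1 ≤ m ≤ 3`, `l ≤ 21`). [cite: FitznerVanDerHofstad2016NoBLE, §3.3.5 (3.87) p. 1079; §5.1 p. 1093; §5.2 (5.9), (5.11), (5.15) p. 1092] -/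
theorem srwTS_le_tQD_on {C : Set (Fin 10 → ℤ)} (hC : C ⊆ Q10) {a : ℝ} (ha : 1 ≤ a) {m : ℕ} (hm1 : 1 ≤ m) (hm : m ≤ 3)
    {l : ℕ} (hl : l ≤ 21) : ∀ x ∈ C, srwTS 10 a m l x ≤ tQD a m l :=
  fun x hx => le_min (srwTS_le_tQ_on hC ha hm1 hm hl x hx)
    (srwTS_le_direct (by linarith) x (srwK_le_kQ_on hC hm1 (by omega) (by omega) x hx)
      (srwU_le_uQ_on hC (by omega) (by omega) (by omega) x hx))

/-- `srwTS 10 a m l (nd.pt) ≤ tND a nd m l` (`1 ≤ a`, `1 ≤ m ≤ 3`, `l ≤ 17` — the `uA` rows stop at `l = 17`). [cite: FitznerVanDerHofstad2016NoBLE, §3.3.5 (3.87) p. 1079; §5.2 (5.9), (5.11), (5.15) p. 1092] -/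
theorem srwTS_pt_le_tND {a : ℝ} (ha : 1 ≤ a) (nd : Nd) {m : ℕ} (hm1 : 1 ≤ m) (hm : m ≤ 3) {l : ℕ} (hl : l ≤ 17) :
    srwTS 10 a m l nd.pt ≤ tND a nd m l :=
  le_min (srwTS_pt_le ha nd hm1 hm (by omega))
    (srwTS_le_direct (by linarith) nd.pt (srwK_pt_le nd hm1 (by omega) (by omega))
      (srwU_pt_le nd (by omega) (by omega) hl))

/-- `srwTS 10 a m l 0 ≤ tND a n0 m l` (`1 ≤ a`, `1 ≤ m ≤ 3`, `l ≤ 17`). [cite: FitznerVanDerHofstad2016NoBLE, §3.3.5 (3.87) p. 1079 (cell `{0}`); §5.2 (5.9), (5.11), (5.15) p. 1092] -/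
theorem srwTS_zero_le_tND {a : ℝ} (ha : 1 ≤ a) {m : ℕ} (hm1 : 1 ≤ m) (hm : m ≤ 3) {l : ℕ} (hl : l ≤ 17) :
    srwTS 10 a m l 0 ≤ tND a .n0 m l := by
  have h := srwTS_pt_le_tND ha .n0 hm1 hm hl
  rwa [Nd.pt_n0] at h

/-- **Cell `(0,l)` over `𝒳` at `d := 10` with the DIRECT `T`-slot literal `tXD α̲`** (`l ≤ 20`); otherwise as `f3cellD10_zero_calX_le`.
[cite: FitznerVanDerHofstad2016NoBLE, §3.3.5 (3.87) p. 1079; (3.71)–(3.86); §5.2 (5.9), (5.15)] [cite: FitznerVanDerHofstad2017, §2.5; notebook General.nb In[2]–In[3]] -/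
theorem f3cellD10D_zero_calX_le (hα : 1 ≤ afmin) (hᾱ : 1 ≤ afmax) {a : Args} (ha : a.WF)
    {IMc : ℤ → ℕ → ℝ} {l : ℕ} (hl : l ≤ 20) {b : ℝ}
    (hE0 : CellDomAlt 10 afmin afmax 0 l (IMc 0 l)) (hE0' : CellDomAlt 10 afmin afmax 0 (l + 1) (IMc 0 (l + 1)))
    (hN1 : srwINode2 10 1 (l + 1) + srwIShift2Node2 10 2 l / (2 * ((10 : ℕ) : ℝ) ^ 2 * afmin) ≤ IMc (-1) l)
    (hN2 : srwINode2 10 2 l ≤ ((10 : ℕ) : ℝ) * afmin * IMc (-1) l)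
    (hnum : boundHD75 (Tables.cell IMc (tXD afmin) uX kX : Tables (Fin 10 → ℤ)) 0 l 0 a ≤ b) :
    ∀ x ∈ calX 10, boundHD75 (srwTrueAlt 10 afmin afmax) 0 l x a ≤ b :=
  boundHD75_srwTrueAlt_zero_cell_le (by norm_num) (by linarith) hᾱ ha hE0 hE0' hN1 hN2
    (srwTS_calX_le_tXD hα (by norm_num) (by norm_num) (by omega)) (srwTS_calX_le_tXD hα (by norm_num) (by norm_num) (by omega))
    (srwTS_calX_le_tXD hα (by norm_num) (by norm_num) (by omega))
    (srwU_calX_le (by norm_num) (by norm_num) (by omega)) (srwU_calX_le (by norm_num) (by norm_num) (by omega))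
    (srwK_calX_le (by norm_num) (by norm_num) (by omega)) (srwK_calX_le (by norm_num) (by norm_num) (by omega)) hnum

/-- **Cells `(1,l)` over `𝒳` at `d := 10` with the DIRECT `T`-slot literal `tXD α̲`** (`l ≤ 20`); otherwise as `f3cellD10_one_calX_le`.
[cite: FitznerVanDerHofstad2016NoBLE, §3.3.5 (3.87) p. 1079; (3.71)–(3.86); §5.2 (5.9), (5.15)] [cite: FitznerVanDerHofstad2017, §2.5; notebook General.nb In[2]–In[3]] -/
theorem f3cellD10D_one_calX_le (hα : 1 ≤ afmin) (hᾱ : 1 ≤ afmax) {a : Args} (ha : a.WF)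
    {IMc : ℤ → ℕ → ℝ} {l : ℕ} (hl : l ≤ 20) {b : ℝ}
    (hE1 : CellDomAlt 10 afmin afmax 1 l (IMc 1 l)) (hE0 : CellDomAlt 10 afmin afmax 0 l (IMc 0 l))
    (hE1' : CellDomAlt 10 afmin afmax 1 (l + 1) (IMc 1 (l + 1))) (hE0' : CellDomAlt 10 afmin afmax 0 (l + 1) (IMc 0 (l + 1)))
    (hE1'' : CellDomAlt 10 afmin afmax 1 (l + 2) (IMc 1 (l + 2)))
    (hnum : boundHD75 (Tables.cell IMc (tXD afmin) uX kX : Tables (Fin 10 → ℤ)) 1 l 0 a ≤ b) :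
    ∀ x ∈ calX 10, boundHD75 (srwTrueAlt 10 afmin afmax) 1 l x a ≤ b :=
  boundHD75_srwTrueAlt_one_cell_le (by norm_num) (by linarith) hᾱ ha hE1 hE0 hE1' hE0' hE1''
    (srwTS_calX_le_tXD hα (by norm_num) (by norm_num) (by omega)) (srwTS_calX_le_tXD hα (by norm_num) (by norm_num) (by omega))
    (srwTS_calX_le_tXD hα (by norm_num) (by norm_num) (by omega))
    (srwU_calX_le (by norm_num) (by norm_num) (by omega)) (srwU_calX_le (by norm_num) (by norm_num) (by omega))
    (srwK_calX_le (by norm_num) (by norm_num) (by omega)) (srwK_calX_le (by norm_num) (by norm_num) (by omega)) hnum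

/-- **Cell `(0,l)` over a set `C ⊆ Q10` at `d := 10` with the DIRECT `T`-slot literal `tQD α̲`** (`l ≤ 20`); otherwise as `f3cellD10_zero_on_le`.
[cite: FitznerVanDerHofstad2016NoBLE, §3.3.5 (3.87) p. 1079; §5.1 p. 1093; (3.71)–(3.86); §5.2 (5.9), (5.15)] [cite: FitznerVanDerHofstad2017, §2.5; notebook Percolation.nb (`boundF3[2,o]`, `boundF3[3,o]`)] -/
theorem f3cellD10D_zero_on_le {C : Set (Fin 10 → ℤ)} (hC : C ⊆ Q10) (hα : 1 ≤ afmin) (hᾱ : 1 ≤ afmax) {a : Args} (ha : a.WF)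
    {IMc : ℤ → ℕ → ℝ} {l : ℕ} (hl : l ≤ 20) {b : ℝ}
    (hE0 : OnDomAlt 10 afmin afmax C 0 l (IMc 0 l)) (hE0' : OnDomAlt 10 afmin afmax C 0 (l + 1) (IMc 0 (l + 1)))
    (hN1 : ∀ x ∈ C, srwI 10 1 (l + 1) x + srwIShift2 10 2 l x / (2 * ((10 : ℕ) : ℝ) ^ 2 * afmin) ≤ IMc (-1) l)
    (hN2 : ∀ x ∈ C, srwI 10 2 l x ≤ ((10 : ℕ) : ℝ) * afmin * IMc (-1) l)
    (hnum : boundHD75 (Tables.cell IMc (tQD afmin) uQ kQ : Tables (Fin 10 → ℤ)) 0 l 0 a ≤ b) :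
    ∀ x ∈ C, boundHD75 (srwTrueAlt 10 afmin afmax) 0 l x a ≤ b :=
  boundHD75_srwTrueAlt_zero_le_on (by norm_num) (by linarith) hᾱ ha C hE0 hE0' hN1 hN2
    (srwTS_le_tQD_on hC hα (by norm_num) (by norm_num) (by omega)) (srwTS_le_tQD_on hC hα (by norm_num) (by norm_num) (by omega))
    (srwTS_le_tQD_on hC hα (by norm_num) (by norm_num) (by omega))
    (srwU_le_uQ_on hC (by norm_num) (by norm_num) (by omega)) (srwU_le_uQ_on hC (by norm_num) (by norm_num) (by omega))
    (srwK_le_kQ_on hC (by norm_num) (by norm_num) (by omega)) (srwK_le_kQ_on hC (by norm_num) (by norm_num) (by omega)) hnum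

/-- **Cells `(1,l)` over a set `C ⊆ Q10` at `d := 10` with the DIRECT `T`-slot literal `tQD α̲`** (`l ≤ 20`); otherwise as `f3cellD10_one_on_le`.
[cite: FitznerVanDerHofstad2016NoBLE, §3.3.5 (3.87) p. 1079; §5.1 p. 1093; (3.71)–(3.86); §5.2 (5.9), (5.15)] [cite: FitznerVanDerHofstad2017, §2.5; notebook Percolation.nb (`boundF3[2,o]`, `boundF3[3,o]`)] -/
theorem f3cellD10D_one_on_le {C : Set (Fin 10 → ℤ)} (hC : C ⊆ Q10) (hα : 1 ≤ afmin) (hᾱ : 1 ≤ afmax) {a : Args} (ha : a.WF)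
    {IMc : ℤ → ℕ → ℝ} {l : ℕ} (hl : l ≤ 20) {b : ℝ}
    (hE1 : OnDomAlt 10 afmin afmax C 1 l (IMc 1 l)) (hE0 : OnDomAlt 10 afmin afmax C 0 l (IMc 0 l))
    (hE1' : OnDomAlt 10 afmin afmax C 1 (l + 1) (IMc 1 (l + 1))) (hE0' : OnDomAlt 10 afmin afmax C 0 (l + 1) (IMc 0 (l + 1)))
    (hE1'' : OnDomAlt 10 afmin afmax C 1 (l + 2) (IMc 1 (l + 2)))
    (hnum : boundHD75 (Tables.cell IMc (tQD afmin) uQ kQ : Tables (Fin 10 → ℤ)) 1 l 0 a ≤ b) :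
    ∀ x ∈ C, boundHD75 (srwTrueAlt 10 afmin afmax) 1 l x a ≤ b :=
  boundHD75_srwTrueAlt_one_le_on (by norm_num) (by linarith) hᾱ ha C hE1 hE0 hE1' hE0' hE1''
    (srwTS_le_tQD_on hC hα (by norm_num) (by norm_num) (by omega)) (srwTS_le_tQD_on hC hα (by norm_num) (by norm_num) (by omega))
    (srwTS_le_tQD_on hC hα (by norm_num) (by norm_num) (by omega))
    (srwU_le_uQ_on hC (by norm_num) (by norm_num) (by omega)) (srwU_le_uQ_on hC (by norm_num) (by norm_num) (by omega))
    (srwK_le_kQ_on hC (by norm_num) (by norm_num) (by omega)) (srwK_le_kQ_on hC (by norm_num) (by norm_num) (by omega)) hnum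

/-- **Cell `(0,l)` over `Q10` with the DIRECT `T`-slot literal** — the `h0Q` shape of the small-`x` `X`-module at `d := 10` (`l ≤ 20`).
[cite: FitznerVanDerHofstad2016NoBLE, §3.3.5 (3.87) p. 1079; §5.1 p. 1093; §5.2 (5.9), (5.15)] [cite: FitznerVanDerHofstad2017, §2.5; notebook Percolation.nb (`boundF3[2,o]`)] -/
theorem f3cellD10D_zero_Q_le (hα : 1 ≤ afmin) (hᾱ : 1 ≤ afmax) {a : Args} (ha : a.WF)
    {IMc : ℤ → ℕ → ℝ} {l : ℕ} (hl : l ≤ 20) {b : ℝ}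
    (hE0 : OnDomAlt 10 afmin afmax Q10 0 l (IMc 0 l)) (hE0' : OnDomAlt 10 afmin afmax Q10 0 (l + 1) (IMc 0 (l + 1)))
    (hN1 : ∀ x ∈ Q10, srwI 10 1 (l + 1) x + srwIShift2 10 2 l x / (2 * ((10 : ℕ) : ℝ) ^ 2 * afmin) ≤ IMc (-1) l)
    (hN2 : ∀ x ∈ Q10, srwI 10 2 l x ≤ ((10 : ℕ) : ℝ) * afmin * IMc (-1) l)
    (hnum : boundHD75 (Tables.cell IMc (tQD afmin) uQ kQ : Tables (Fin 10 → ℤ)) 0 l 0 a ≤ b) :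
    ∀ x : Fin 10 → ℤ, 3 ≤ ∑ j, |x j| → boundHD75 (srwTrueAlt 10 afmin afmax) 0 l x a ≤ b :=
  fun x hx => f3cellD10D_zero_on_le subset_rfl hα hᾱ ha hl hE0 hE0' hN1 hN2 hnum x hx

/-- **Cells `(1,l)` over `Q10` with the DIRECT `T`-slot literal** — the `h1Q` shape of the small-`x` `X`-module at `d := 10` (`l ≤ 20`).
[cite: FitznerVanDerHofstad2016NoBLE, §3.3.5 (3.87) p. 1079; §5.1 p. 1093; §5.2 (5.9), (5.15)] [cite: FitznerVanDerHofstad2017, §2.5; notebook Percolation.nb (`boundF3[3,o]`)] -/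
theorem f3cellD10D_one_Q_le (hα : 1 ≤ afmin) (hᾱ : 1 ≤ afmax) {a : Args} (ha : a.WF)
    {IMc : ℤ → ℕ → ℝ} {l : ℕ} (hl : l ≤ 20) {b : ℝ}
    (hE1 : OnDomAlt 10 afmin afmax Q10 1 l (IMc 1 l)) (hE0 : OnDomAlt 10 afmin afmax Q10 0 l (IMc 0 l))
    (hE1' : OnDomAlt 10 afmin afmax Q10 1 (l + 1) (IMc 1 (l + 1))) (hE0' : OnDomAlt 10 afmin afmax Q10 0 (l + 1) (IMc 0 (l + 1)))
    (hE1'' : OnDomAlt 10 afmin afmax Q10 1 (l + 2) (IMc 1 (l + 2)))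
    (hnum : boundHD75 (Tables.cell IMc (tQD afmin) uQ kQ : Tables (Fin 10 → ℤ)) 1 l 0 a ≤ b) :
    ∀ x : Fin 10 → ℤ, 3 ≤ ∑ j, |x j| → boundHD75 (srwTrueAlt 10 afmin afmax) 1 l x a ≤ b :=
  fun x hx => f3cellD10D_one_on_le subset_rfl hα hᾱ ha hl hE1 hE0 hE1' hE0' hE1'' hnum x hx

/-- **Cell `(1,l)` at the origin with the DIRECT `T`-slot literal `tND α̲ n0`** (`l ≤ 16`: the slot at `(m,l+1)` reads `uN n0 (m+1) (l+1)`,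
`l + 1 ≤ 17`); otherwise as `f3cellD10_one_zero_le`. [cite: FitznerVanDerHofstad2016NoBLE, §3.3.5 (3.87) p. 1079 (cell `{0}`); (3.30), (3.35); §5.2 (5.9), (5.15)] [cite: FitznerVanDerHofstad2017, §2.5; notebook Percolation.nb (`boundF3[1,o]`)] -/
theorem f3cellD10D_one_zero_le (hα : 1 ≤ afmin) {a : Args} (ha : a.WF)
    {IMc : ℤ → ℕ → ℝ} {l : ℕ} (hl : l ≤ 16) {b : ℝ}
    (hE1 : OriginDomAlt 10 afmin afmax 1 l (IMc 1 l)) (hE0 : OriginDomAlt 10 afmin afmax 0 l (IMc 0 l))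
    (hE1' : OriginDomAlt 10 afmin afmax 1 (l + 1) (IMc 1 (l + 1))) (hE0' : OriginDomAlt 10 afmin afmax 0 (l + 1) (IMc 0 (l + 1)))
    (hE1'' : OriginDomAlt 10 afmin afmax 1 (l + 2) (IMc 1 (l + 2)))
    (hnum : boundHD75 (Tables.cell IMc (tND afmin .n0) (uN .n0) (kN .n0) : Tables (Fin 10 → ℤ)) 1 l 0 a ≤ b) :
    boundHD75 (srwTrueAlt 10 afmin afmax) 1 l 0 a ≤ b :=
  boundHD75_srwTrueAlt_one_zero_le (by norm_num) (by linarith) ha hE1 hE0 hE1' hE0' hE1''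
    (srwTS_zero_le_tND hα (by norm_num) (by norm_num) (by omega)) (srwTS_zero_le_tND hα (by norm_num) (by norm_num) (by omega))
    (srwTS_zero_le_tND hα (by norm_num) (by norm_num) (by omega))
    (srwU_zero_le (by norm_num) (by norm_num) (by omega)) (srwU_zero_le (by norm_num) (by norm_num) (by omega))
    (srwK_zero_le (by norm_num) (by norm_num) (by omega)) (srwK_zero_le (by norm_num) (by norm_num) (by omega)) hnum

/-- **Cell `(0,l)` AT the node `nd` with the DIRECT `T`-slot literal `tND α̲ nd`** (`l ≤ 16`); otherwise as `f3cellD10_zero_at_le`.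
[cite: FitznerVanDerHofstad2016NoBLE, §3.3.5 (3.87) p. 1079; (3.71)–(3.86); §5.2 (5.9), (5.15)] [cite: FitznerVanDerHofstad2017, §2.5, notebook Percolation.nb] -/
theorem f3cellD10D_zero_at_le (hα : 1 ≤ afmin) {a : Args} (ha : a.WF) (nd : Nd)
    {IMc : ℤ → ℕ → ℝ} {l : ℕ} (hl : l ≤ 16) {b : ℝ}
    (hE0 : (srwTrueAlt 10 afmin afmax).IM 0 l nd.pt ≤ IMc 0 l) (hE0' : (srwTrueAlt 10 afmin afmax).IM 0 (l + 1) nd.pt ≤ IMc 0 (l + 1))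
    (hN1 : srwI 10 1 (l + 1) nd.pt + srwIShift2 10 2 l nd.pt / (2 * ((10 : ℕ) : ℝ) ^ 2 * afmin) ≤ IMc (-1) l)
    (hN2 : srwI 10 2 l nd.pt ≤ ((10 : ℕ) : ℝ) * afmin * IMc (-1) l)
    (hnum : boundHD75 (Tables.cell IMc (tND afmin nd) (uN nd) (kN nd) : Tables (Fin 10 → ℤ)) 0 l 0 a ≤ b) :
    boundHD75 (srwTrueAlt 10 afmin afmax) 0 l nd.pt a ≤ b :=
  boundHD75_srwTrueAlt_zero_at_le (by norm_num) (by linarith) ha nd.pt hE0 hE0' hN1 hN2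
    (srwTS_pt_le_tND hα nd (by norm_num) (by norm_num) (by omega)) (srwTS_pt_le_tND hα nd (by norm_num) (by norm_num) (by omega))
    (srwTS_pt_le_tND hα nd (by norm_num) (by norm_num) (by omega))
    (srwU_pt_le nd (by norm_num) (by norm_num) (by omega)) (srwU_pt_le nd (by norm_num) (by norm_num) (by omega))
    (srwK_pt_le nd (by norm_num) (by norm_num) (by omega)) (srwK_pt_le nd (by norm_num) (by norm_num) (by omega)) hnum

/-- **Cells `(1,l)` AT the node `nd` with the DIRECT `T`-slot literal `tND α̲ nd`** (`l ≤ 16`); otherwise as `f3cellD10_one_at_le`.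
[cite: FitznerVanDerHofstad2016NoBLE, §3.3.5 (3.87) p. 1079; (3.71)–(3.86); §5.2 (5.9), (5.15)] [cite: FitznerVanDerHofstad2017, §2.5, notebook Percolation.nb] -/
theorem f3cellD10D_one_at_le (hα : 1 ≤ afmin) {a : Args} (ha : a.WF) (nd : Nd)
    {IMc : ℤ → ℕ → ℝ} {l : ℕ} (hl : l ≤ 16) {b : ℝ}
    (hE1 : (srwTrueAlt 10 afmin afmax).IM 1 l nd.pt ≤ IMc 1 l) (hE0 : (srwTrueAlt 10 afmin afmax).IM 0 l nd.pt ≤ IMc 0 l)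
    (hE1' : (srwTrueAlt 10 afmin afmax).IM 1 (l + 1) nd.pt ≤ IMc 1 (l + 1))
    (hE0' : (srwTrueAlt 10 afmin afmax).IM 0 (l + 1) nd.pt ≤ IMc 0 (l + 1))
    (hE1'' : (srwTrueAlt 10 afmin afmax).IM 1 (l + 2) nd.pt ≤ IMc 1 (l + 2))
    (hnum : boundHD75 (Tables.cell IMc (tND afmin nd) (uN nd) (kN nd) : Tables (Fin 10 → ℤ)) 1 l 0 a ≤ b) :
    boundHD75 (srwTrueAlt 10 afmin afmax) 1 l nd.pt a ≤ b :=
  boundHD75_srwTrueAlt_one_at_le ha nd.pt hE1 hE0 hE1' hE0' hE1''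
    (srwTS_pt_le_tND hα nd (by norm_num) (by norm_num) (by omega)) (srwTS_pt_le_tND hα nd (by norm_num) (by norm_num) (by omega))
    (srwTS_pt_le_tND hα nd (by norm_num) (by norm_num) (by omega))
    (srwU_pt_le nd (by norm_num) (by norm_num) (by omega)) (srwU_pt_le nd (by norm_num) (by norm_num) (by omega))
    (srwK_pt_le nd (by norm_num) (by norm_num) (by omega)) (srwK_pt_le nd (by norm_num) (by norm_num) (by omega)) hnum

end CellSupD10

end Literature.Probability.FitznerVanDerHofstad2017
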